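import Literature.MathematicalPhysics.QuantumLattice.KomaPiFluxDoubleCommutator
import HarnessLib

/-!
# The double commutator of the hopping term with `Γ¹_x` (Koma 2022, (6.25)–(6.26))

T. Koma, *Nambu–Goldstone modes for superconducting lattice fermions*, arXiv:2201.13135 (2022)
[Koma2022], §6: the hopping part of the double commutator `[Γ̂¹_{-p}, [H, Γ̂¹_p]]` ((6.25)) is
computed from `[Γ¹_x, a†_{x↑}a_{y↑} - a†_{y↑}a_{x↑}] = a†_{y↑}a†_{x↓} + a_{x↓}a_{y↑}` and bounded by
`‖[Γ̂¹_{-p}, [H_hop, Γ̂¹_p]]‖ ≤ 8d|κ|` ((6.26)).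

In the local (real-space) form used by this series (`|Λ|⁻¹Σ_p c_p ↔ Σ_x [Γ¹_x,[H,Γ¹_x]]`, cf.
`KomaPiFluxDoubleCommutator.lean`) the hopping double commutator is EXPLICIT: for the kinetic term
`K(T) = -Σ_σ Σ_{a∼b} T_σ(a,b) c†_{aσ}c_{bσ}` of a general graph (`peierlsHubbard G T 0`),

  `[Γ¹_x, [K(T), Γ¹_x]] = Σ_{y∼x} Σ_σ (T_σ(y,x) c†_{yσ}c_{xσ} + T_σ(x,y) c†_{xσ}c_{yσ})`

(`PairHopRP.gammaOne_doubleComm_hopping`) — minus the part of `K(T)` living on the bonds at `x` — so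
that `Σ_x [Γ¹_x, [K(T), Γ¹_x]] = -2 K(T)` (`PairHopRP.sum_gammaOne_doubleComm_hopping`). For the
`π`-flux amplitudes (`|T| = κ` on every bond) and ANY Gibbs state this gives Koma's bound in the form
`Σ_x Re⟨[Γ¹_x, [K(T_π), Γ¹_x]]⟩ ≤ 8(d+1)κ L^{d+1}` (`KomaPiFlux.sum_re_gibbsState_doubleComm_hopping_le`,
i.e. `8·D·κ` per site, `D = d+1` the dimension), through `|Re⟨c†_i c_j⟩| ≤ 1`
(`PairHopRP.abs_re_gibbsState_hop_le_one`, positivity of the state). All statements are PROVED;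
no named fact.

## References

* [Koma2022] T. Koma, arXiv:2201.13135, (6.25)–(6.26).
-/

noncomputable section

namespace Literature.MathematicalPhysics.QuantumLattice

open Matrix Finset HubbardWave0
open scoped ComplexOrder

namespace PairHopRP

variable {Λ : Type*} [LinearOrder Λ] [Fintype Λ]

/-! ### Single hopping terms against `Γ^±_x` -/

/-- `[c†_{a↑}c_{b↑}, Γ⁺_x] = δ_{bx} c†_{a↑}c†_{x↓}`. [cite: Koma2022, (6.25)] -/
theorem hop0_comm_gammaPlus (a b x : Λ) :
    creation (orb a 0) * annihilation (orb b 0) * gammaPlus x - gammaPlus x * (creation (orb a 0) * annihilation (orb b 0)) =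
      if b = x then creation (orb a 0) * creation (orb x 1) else 0 := by
  rw [gammaPlus, hop_pair_commutator]
  by_cases hb : b = x
  · subst hb
    rw [if_pos rfl, if_neg (fun h => absurd (orb_eq_orb_iff.1 h).2 (by decide)), sub_zero, if_pos rfl]
  · rw [if_neg (fun h => hb (orb_eq_orb_iff.1 h).1), if_neg (fun h => hb (orb_eq_orb_iff.1 h).1), sub_zero, if_neg hb]

/-- `[c†_{a↓}c_{b↓}, Γ⁺_x] = δ_{bx} c†_{x↑}c†_{a↓}`. [cite: Koma2022, (6.25)] -/
theorem hop1_comm_gammaPlus (a b x : Λ) :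
    creation (orb a 1) * annihilation (orb b 1) * gammaPlus x - gammaPlus x * (creation (orb a 1) * annihilation (orb b 1)) =
      if b = x then creation (orb x 0) * creation (orb a 1) else 0 := by
  rw [gammaPlus, hop_pair_commutator]
  by_cases hb : b = x
  · subst hb
    rw [if_neg (fun h => absurd (orb_eq_orb_iff.1 h).2 (by decide)), if_pos rfl, zero_sub, if_pos rfl,
      creation_mul_creation_eq_neg, neg_neg]
  · rw [if_neg (fun h => hb (orb_eq_orb_iff.1 h).1), if_neg (fun h => hb (orb_eq_orb_iff.1 h).1), sub_zero, if_neg hb]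

/-- `[c†_{a↑}c_{b↑}, Γ⁻_x] = -δ_{ax} c_{x↓}c_{b↑}` (adjoint of `hop0_comm_gammaPlus`). [cite: Koma2022, (6.25)] -/
theorem hop0_comm_gammaMinus (a b x : Λ) :
    creation (orb a 0) * annihilation (orb b 0) * gammaMinus x - gammaMinus x * (creation (orb a 0) * annihilation (orb b 0)) =
      if a = x then -(annihilation (orb x 1) * annihilation (orb b 0)) else 0 := by
  have h := congrArg conjTranspose (hop0_comm_gammaPlus b a x)
  by_cases hax : a = x
  · rw [if_pos hax] at h
    rw [if_pos hax]
    simp only [conjTranspose_sub, conjTranspose_mul, conjTranspose_gammaPlus, creation_conjTranspose,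
      annihilation_conjTranspose, Matrix.mul_assoc] at h
    simp only [Matrix.mul_assoc]
    rw [← neg_sub, h]
  · rw [if_neg hax] at h
    rw [if_neg hax]
    simp only [conjTranspose_sub, conjTranspose_mul, conjTranspose_gammaPlus, creation_conjTranspose,
      annihilation_conjTranspose, Matrix.mul_assoc, conjTranspose_zero] at h
    simp only [Matrix.mul_assoc]
    rw [← neg_sub, h, neg_zero]

/-- `[c†_{a↓}c_{b↓}, Γ⁻_x] = -δ_{ax} c_{b↓}c_{x↑}` (adjoint of `hop1_comm_gammaPlus`). [cite: Koma2022, (6.25)] -/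
theorem hop1_comm_gammaMinus (a b x : Λ) :
    creation (orb a 1) * annihilation (orb b 1) * gammaMinus x - gammaMinus x * (creation (orb a 1) * annihilation (orb b 1)) =
      if a = x then -(annihilation (orb b 1) * annihilation (orb x 0)) else 0 := by
  have h := congrArg conjTranspose (hop1_comm_gammaPlus b a x)
  by_cases hax : a = x
  · rw [if_pos hax] at h
    rw [if_pos hax]
    simp only [conjTranspose_sub, conjTranspose_mul, conjTranspose_gammaPlus, creation_conjTranspose,
      annihilation_conjTranspose, Matrix.mul_assoc] at h
    simp only [Matrix.mul_assoc]
    rw [← neg_sub, h]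
  · rw [if_neg hax] at h
    rw [if_neg hax]
    simp only [conjTranspose_sub, conjTranspose_mul, conjTranspose_gammaPlus, creation_conjTranspose,
      annihilation_conjTranspose, Matrix.mul_assoc, conjTranspose_zero] at h
    simp only [Matrix.mul_assoc]
    rw [← neg_sub, h, neg_zero]

/-! ### `Γ^±_x` against the bond pair operators -/

/-- `c†_r c†_q (c†_p c†_q) = 0` (Pauli). [folklore] -/
private theorem cre_cre_mul_cre_cre_right (r p q : Orb Λ) :
    creation r * creation q * (creation p * creation q) = 0 := by
  rw [Matrix.mul_assoc, creation_comm_pair q p q, Matrix.mul_assoc, creation_mul_self, Matrix.mul_zero, Matrix.mul_zero]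

/-- `c†_q c†_p (c†_q c†_r) = 0` (Pauli). [folklore] -/
private theorem cre_cre_mul_cre_cre_left (q p r : Orb Λ) :
    creation q * creation p * (creation q * creation r) = 0 := by
  rw [Matrix.mul_assoc, creation_comm_pair p q r, ← Matrix.mul_assoc, ← Matrix.mul_assoc, creation_mul_self,
    Matrix.zero_mul, Matrix.zero_mul]

/-- `[Γ⁺_x, c†_{a↑}c†_{x↓}] = 0`. [cite: Koma2022, (6.25)] -/
theorem gammaPlus_comm_pairCre0 (a x : Λ) :
    gammaPlus x * (creation (orb a 0) * creation (orb x 1)) - creation (orb a 0) * creation (orb x 1) * gammaPlus x = 0 := by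
  rw [gammaPlus, cre_cre_mul_cre_cre_right, cre_cre_mul_cre_cre_right, sub_zero]

/-- `[Γ⁺_x, c†_{x↑}c†_{a↓}] = 0`. [cite: Koma2022, (6.25)] -/
theorem gammaPlus_comm_pairCre1 (a x : Λ) :
    gammaPlus x * (creation (orb x 0) * creation (orb a 1)) - creation (orb x 0) * creation (orb a 1) * gammaPlus x = 0 := by
  rw [gammaPlus, cre_cre_mul_cre_cre_left, cre_cre_mul_cre_cre_left, sub_zero]

/-- The master CAR identity: for orbitals `i, j, k` with `i ≠ j`, `k ≠ i`, `k ≠ j`,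
`c_i c_j (c†_k c†_i) - (c†_k c†_i)(c_i c_j) = -c†_k c_j` (CAR bookkeeping behind Koma's
`[Γ¹_x, a†_{x↑}a_{y↑} - a†_{y↑}a_{x↑}] = a†_{y↑}a†_{x↓} + a_{x↓}a_{y↑}`). [cite: Koma2022, (6.25)]
[cite: EsslerEtAl2005, §2.1 eq. (2.2)] -/
theorem ann_ann_comm_cre_cre {i j k : Orb Λ} (hij : i ≠ j) (hki : k ≠ i) (hkj : k ≠ j) :
    annihilation i * annihilation j * (creation k * creation i) - creation k * creation i * (annihilation i * annihilation j) =
      -(creation k * annihilation j) := by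
  have e1 : annihilation j * creation k = -(creation k * annihilation j) := by
    rw [annihilation_mul_creation, if_neg (Ne.symm hkj), zero_sub]
  have e2 : annihilation i * creation k = -(creation k * annihilation i) := by
    rw [annihilation_mul_creation, if_neg (Ne.symm hki), zero_sub]
  have e3 : annihilation j * creation i = -(creation i * annihilation j) := by
    rw [annihilation_mul_creation, if_neg (Ne.symm hij), zero_sub]
  have e4 : annihilation i * creation i = 1 - creation i * annihilation i := by
    rw [annihilation_mul_creation, if_pos rfl]
  have s1 : annihilation i * annihilation j * (creation k * creation i) =
      annihilation i * (annihilation j * creation k) * creation i := by noncomm_ring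
  rw [s1, e1]
  have s2 : annihilation i * -(creation k * annihilation j) * creation i =
      -((annihilation i * creation k) * (annihilation j * creation i)) := by noncomm_ring
  rw [s2, e2, e3]
  have s3 : -(-(creation k * annihilation i) * -(creation i * annihilation j)) =
      -(creation k * (annihilation i * creation i) * annihilation j) := by noncomm_ring
  rw [s3, e4]
  noncomm_ring

/-- `[Γ⁻_x, c†_{a↑}c†_{x↓}] = -c†_{a↑}c_{x↑}` for `a ≠ x`. [cite: Koma2022, (6.25)] -/
theorem gammaMinus_comm_pairCre0 {a x : Λ} (hax : a ≠ x) :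
    gammaMinus x * (creation (orb a 0) * creation (orb x 1)) - creation (orb a 0) * creation (orb x 1) * gammaMinus x =
      -(creation (orb a 0) * annihilation (orb x 0)) := by
  rw [gammaMinus]
  exact ann_ann_comm_cre_cre (fun h => absurd (orb_eq_orb_iff.1 h).2 (by decide))
    (fun h => hax (orb_eq_orb_iff.1 h).1) (fun h => hax (orb_eq_orb_iff.1 h).1)

/-- `[Γ⁻_x, c†_{x↑}c†_{a↓}] = -c†_{a↓}c_{x↓}` for `a ≠ x`. [cite: Koma2022, (6.25)] -/
theorem gammaMinus_comm_pairCre1 {a x : Λ} (hax : a ≠ x) :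
    gammaMinus x * (creation (orb x 0) * creation (orb a 1)) - creation (orb x 0) * creation (orb a 1) * gammaMinus x =
      -(creation (orb a 1) * annihilation (orb x 1)) := by
  have hm : gammaMinus x = -(annihilation (orb x 0) * annihilation (orb x 1)) := by
    rw [gammaMinus]
    exact eq_neg_of_add_eq_zero_left (annihilation_anticommute_holds (orb x 1) (orb x 0))
  have hc : creation (orb x 0) * creation (orb a 1) = -(creation (orb a 1) * creation (orb x 0)) :=
    creation_mul_creation_eq_neg _ _
  rw [hm, hc, Matrix.neg_mul, Matrix.mul_neg, Matrix.neg_mul, Matrix.mul_neg, neg_neg, neg_neg]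
  exact ann_ann_comm_cre_cre (fun h => absurd (orb_eq_orb_iff.1 h).2 (by decide))
    (fun h => hax (orb_eq_orb_iff.1 h).1) (fun h => hax (orb_eq_orb_iff.1 h).1)

/-- `[Γ⁺_x, c_{x↓}c_{b↑}] = c†_{x↑}c_{b↑}` for `b ≠ x`. [cite: Koma2022, (6.25)] -/
theorem gammaPlus_comm_pairAnn0 {b x : Λ} (hbx : b ≠ x) :
    gammaPlus x * (annihilation (orb x 1) * annihilation (orb b 0)) - annihilation (orb x 1) * annihilation (orb b 0) * gammaPlus x =
      creation (orb x 0) * annihilation (orb b 0) := by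
  have h := ann_ann_comm_cre_cre (i := orb x 1) (j := orb b 0) (k := orb x 0)
    (fun h => hbx (orb_eq_orb_iff.1 h).1.symm) (fun h => absurd (orb_eq_orb_iff.1 h).2 (by decide))
    (fun h => hbx (orb_eq_orb_iff.1 h).1.symm)
  rw [gammaPlus, ← neg_sub, h, neg_neg]

/-- `[Γ⁺_x, c_{b↓}c_{x↑}] = c†_{x↓}c_{b↓}` for `b ≠ x`. [cite: Koma2022, (6.25)] -/
theorem gammaPlus_comm_pairAnn1 {b x : Λ} (hbx : b ≠ x) :
    gammaPlus x * (annihilation (orb b 1) * annihilation (orb x 0)) - annihilation (orb b 1) * annihilation (orb x 0) * gammaPlus x =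
      creation (orb x 1) * annihilation (orb b 1) := by
  have hp : gammaPlus x = -(creation (orb x 1) * creation (orb x 0)) := by
    rw [gammaPlus]; exact creation_mul_creation_eq_neg _ _
  have ha : annihilation (orb b 1) * annihilation (orb x 0) = -(annihilation (orb x 0) * annihilation (orb b 1)) :=
    eq_neg_of_add_eq_zero_left (annihilation_anticommute_holds (orb b 1) (orb x 0))
  have h := ann_ann_comm_cre_cre (i := orb x 0) (j := orb b 1) (k := orb x 1)
    (fun h => hbx (orb_eq_orb_iff.1 h).1.symm) (fun h => absurd (orb_eq_orb_iff.1 h).2 (by decide))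
    (fun h => hbx (orb_eq_orb_iff.1 h).1.symm)
  rw [hp, ha, Matrix.neg_mul, Matrix.mul_neg, Matrix.neg_mul, Matrix.mul_neg, neg_neg, neg_neg, ← neg_sub, h, neg_neg]

/-- `[Γ⁻_x, c c] = 0` for the bond pair annihilators (adjoint Pauli). [cite: Koma2022, (6.25)] -/
theorem gammaMinus_comm_pairAnn0 (b x : Λ) :
    gammaMinus x * (annihilation (orb x 1) * annihilation (orb b 0)) - annihilation (orb x 1) * annihilation (orb b 0) * gammaMinus x = 0 := by
  have h := congrArg conjTranspose (gammaPlus_comm_pairCre0 b x)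
  simp only [conjTranspose_sub, conjTranspose_mul, conjTranspose_gammaPlus, creation_conjTranspose, conjTranspose_zero] at h
  rw [← neg_sub, h, neg_zero]

/-- `[Γ⁻_x, c_{b↓}c_{x↑}] = 0`. [cite: Koma2022, (6.25)] -/
theorem gammaMinus_comm_pairAnn1 (b x : Λ) :
    gammaMinus x * (annihilation (orb b 1) * annihilation (orb x 0)) - annihilation (orb b 1) * annihilation (orb x 0) * gammaMinus x = 0 := by
  have h := congrArg conjTranspose (gammaPlus_comm_pairCre1 b x)
  simp only [conjTranspose_sub, conjTranspose_mul, conjTranspose_gammaPlus, creation_conjTranspose, conjTranspose_zero] at h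
  rw [← neg_sub, h, neg_zero]

/-! ### `[K(T), Γ^±_x]` -/

section Graph

variable (G : SimpleGraph Λ) [DecidableRel G.Adj]

/-- `K(T) = peierlsHubbard G T 0 = -Σ_a Σ_b Σ_σ [a∼b] T_σ(a,b) c†_{aσ}c_{bσ}`. [cite: Lieb1994, eq. (1)] -/
theorem peierlsHubbard_zero_eq (T : Fin 2 → Λ → Λ → ℂ) :
    peierlsHubbard G T 0 = -∑ a : Λ, ∑ b : Λ, ∑ σ : Fin 2,
      if G.Adj a b then T σ a b • (creation (orb a σ) * annihilation (orb b σ)) else 0 := by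
  rw [peierlsHubbard_def, Complex.ofReal_zero, zero_smul, add_zero]

/-- Commutator of a triple sum (bookkeeping). [folklore] -/
private theorem tripleSum_comm {α γ m : Type*} [Fintype α] [Fintype γ] [Fintype m] [DecidableEq m]
    (S : α → α → γ → Matrix m m ℂ) (X : Matrix m m ℂ) :
    (-∑ a : α, ∑ b : α, ∑ σ : γ, S a b σ) * X - X * (-∑ a : α, ∑ b : α, ∑ σ : γ, S a b σ) =
      -∑ a : α, ∑ b : α, ∑ σ : γ, (S a b σ * X - X * S a b σ) := by
  simp only [Matrix.neg_mul, Matrix.mul_neg, Finset.sum_mul, Finset.mul_sum, Finset.sum_sub_distrib]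
  abel

/-- `(if P then t • A else 0) X - X (if P then t • A else 0) = if P then t • (A X - X A) else 0`. [folklore] -/
private theorem ite_smul_comm {m : Type*} [Fintype m] (P : Prop) [Decidable P] (t : ℂ) (A X : Matrix m m ℂ) :
    (if P then t • A else 0) * X - X * (if P then t • A else 0) = if P then t • (A * X - X * A) else 0 := by
  split_ifs
  · rw [Matrix.smul_mul, Matrix.mul_smul, smul_sub]
  · rw [Matrix.zero_mul, Matrix.mul_zero, sub_zero]

/-- **`[K(T), Γ⁺_x] = -Σ_{a∼x} (T_↑(a,x) c†_{a↑}c†_{x↓} + T_↓(a,x) c†_{x↑}c†_{a↓})`** (pair creation on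
the bonds at `x`). [cite: Koma2022, (6.25)] -/
theorem hopping_comm_gammaPlus (T : Fin 2 → Λ → Λ → ℂ) (x : Λ) :
    peierlsHubbard G T 0 * gammaPlus x - gammaPlus x * peierlsHubbard G T 0 =
      -∑ a : Λ, if G.Adj a x then
        T 0 a x • (creation (orb a 0) * creation (orb x 1)) + T 1 a x • (creation (orb x 0) * creation (orb a 1)) else 0 := by
  rw [peierlsHubbard_zero_eq, tripleSum_comm]
  congr 1
  refine Finset.sum_congr rfl fun a _ => ?_
  simp only [Fin.sum_univ_two, ite_smul_comm, hop0_comm_gammaPlus, hop1_comm_gammaPlus, Finset.sum_add_distrib]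
  rw [Finset.sum_eq_single x (fun b _ hb => by rw [if_neg hb, smul_zero, ite_self])
      (fun h => absurd (Finset.mem_univ x) h),
    Finset.sum_eq_single x (fun b _ hb => by rw [if_neg hb, smul_zero, ite_self])
      (fun h => absurd (Finset.mem_univ x) h), if_pos rfl, if_pos rfl]
  split_ifs
  · rfl
  · rw [add_zero]

/-- **`[K(T), Γ⁻_x] = Σ_{b∼x} (T_↑(x,b) c_{x↓}c_{b↑} + T_↓(x,b) c_{b↓}c_{x↑})`**. [cite: Koma2022, (6.25)] -/
theorem hopping_comm_gammaMinus (T : Fin 2 → Λ → Λ → ℂ) (x : Λ) :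
    peierlsHubbard G T 0 * gammaMinus x - gammaMinus x * peierlsHubbard G T 0 =
      ∑ b : Λ, if G.Adj x b then
        T 0 x b • (annihilation (orb x 1) * annihilation (orb b 0)) + T 1 x b • (annihilation (orb b 1) * annihilation (orb x 0)) else 0 := by
  rw [peierlsHubbard_zero_eq, tripleSum_comm, Finset.sum_comm]
  rw [← Finset.sum_neg_distrib]
  refine Finset.sum_congr rfl fun b _ => ?_
  simp only [Fin.sum_univ_two, ite_smul_comm, hop0_comm_gammaMinus, hop1_comm_gammaMinus, Finset.sum_add_distrib]
  rw [Finset.sum_eq_single x (fun a _ ha => by rw [if_neg ha, smul_zero, ite_self])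
      (fun h => absurd (Finset.mem_univ x) h),
    Finset.sum_eq_single x (fun a _ ha => by rw [if_neg ha, smul_zero, ite_self])
      (fun h => absurd (Finset.mem_univ x) h), if_pos rfl, if_pos rfl]
  split_ifs
  · rw [smul_neg, smul_neg, ← neg_add, neg_neg]
  · rw [add_zero, neg_zero]

/-! ### The double commutator -/

/-- `X (Σ_a if P a then F a else 0) - (Σ …) X = Σ_a if P a then (X F a - F a X) else 0`. [folklore] -/
private theorem comm_sum_ite {α m : Type*} [Fintype α] [Fintype m] (X : Matrix m m ℂ) (P : α → Prop) [DecidablePred P]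
    (F : α → Matrix m m ℂ) :
    X * (∑ a : α, if P a then F a else 0) - (∑ a : α, if P a then F a else 0) * X =
      ∑ a : α, if P a then X * F a - F a * X else 0 := by
  rw [Finset.mul_sum, Finset.sum_mul, ← Finset.sum_sub_distrib]
  refine Finset.sum_congr rfl fun a _ => ?_
  split_ifs
  · rfl
  · rw [Matrix.mul_zero, Matrix.zero_mul, sub_zero]

/-- `X (tA + sB) - (tA + sB) X = t(XA - AX) + s(XB - BX)`. [folklore] -/
private theorem comm_two_smul {m : Type*} [Fintype m] (X A B : Matrix m m ℂ) (t s : ℂ) :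
    X * (t • A + s • B) - (t • A + s • B) * X = t • (X * A - A * X) + s • (X * B - B * X) := by
  rw [Matrix.mul_add, Matrix.add_mul, Matrix.mul_smul, Matrix.mul_smul, Matrix.smul_mul, Matrix.smul_mul, smul_sub, smul_sub]
  abel

/-- **The local hopping double commutator** (generic graph and amplitudes):
`[Γ¹_x, [K(T), Γ¹_x]] = Σ_{y∼x} Σ_σ (T_σ(y,x) c†_{yσ}c_{xσ} + T_σ(x,y) c†_{xσ}c_{yσ})`.
[cite: Koma2022, (6.25)–(6.26)] -/
theorem gammaOne_doubleComm_hopping (T : Fin 2 → Λ → Λ → ℂ) (x : Λ) :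
    gammaOne x * (peierlsHubbard G T 0 * gammaOne x - gammaOne x * peierlsHubbard G T 0) -
        (peierlsHubbard G T 0 * gammaOne x - gammaOne x * peierlsHubbard G T 0) * gammaOne x =
      ∑ y : Λ, if G.Adj x y then
        ∑ σ : Fin 2, (T σ y x • (creation (orb y σ) * annihilation (orb x σ)) +
          T σ x y • (creation (orb x σ) * annihilation (orb y σ))) else 0 := by
  -- `[K, Γ¹] = [K, Γ⁺] + [K, Γ⁻]`
  have hsplit : peierlsHubbard G T 0 * gammaOne x - gammaOne x * peierlsHubbard G T 0 =
      (peierlsHubbard G T 0 * gammaPlus x - gammaPlus x * peierlsHubbard G T 0) +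
        (peierlsHubbard G T 0 * gammaMinus x - gammaMinus x * peierlsHubbard G T 0) := by
    rw [gammaOne, Matrix.mul_add, Matrix.add_mul]; abel
  rw [hsplit, hopping_comm_gammaPlus, hopping_comm_gammaMinus]
  -- `[Γ⁺ + Γ⁻, -P + M]`
  have halg : ∀ (Y P M : Matrix (Finset (Orb Λ)) (Finset (Orb Λ)) ℂ),
      Y * (-P + M) - (-P + M) * Y = -(Y * P - P * Y) + (Y * M - M * Y) := by
    intros; noncomm_ring
  rw [halg, gammaOne]
  have hP : (gammaPlus x + gammaMinus x) *
        (∑ a : Λ, if G.Adj a x then T 0 a x • (creation (orb a 0) * creation (orb x 1)) +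
          T 1 a x • (creation (orb x 0) * creation (orb a 1)) else 0) -
      (∑ a : Λ, if G.Adj a x then T 0 a x • (creation (orb a 0) * creation (orb x 1)) +
          T 1 a x • (creation (orb x 0) * creation (orb a 1)) else 0) * (gammaPlus x + gammaMinus x) =
      -∑ a : Λ, if G.Adj a x then T 0 a x • (creation (orb a 0) * annihilation (orb x 0)) +
          T 1 a x • (creation (orb a 1) * annihilation (orb x 1)) else 0 := by
    rw [comm_sum_ite, ← Finset.sum_neg_distrib]
    refine Finset.sum_congr rfl fun a _ => ?_
    split_ifs with hax
    · have hne : a ≠ x := fun h => G.irrefl (h ▸ hax)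
      rw [comm_two_smul, Matrix.add_mul, Matrix.mul_add, Matrix.add_mul, Matrix.mul_add,
        show ∀ A B C D : Matrix (Finset (Orb Λ)) (Finset (Orb Λ)) ℂ, A + B - (C + D) = (A - C) + (B - D) from
          fun _ _ _ _ => by abel,
        show ∀ A B C D : Matrix (Finset (Orb Λ)) (Finset (Orb Λ)) ℂ, A + B - (C + D) = (A - C) + (B - D) from
          fun _ _ _ _ => by abel,
        gammaPlus_comm_pairCre0, gammaMinus_comm_pairCre0 hne, gammaPlus_comm_pairCre1, gammaMinus_comm_pairCre1 hne,
        zero_add, zero_add, smul_neg, smul_neg, neg_add]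
    · rw [neg_zero]
  have hM : (gammaPlus x + gammaMinus x) *
        (∑ b : Λ, if G.Adj x b then T 0 x b • (annihilation (orb x 1) * annihilation (orb b 0)) +
          T 1 x b • (annihilation (orb b 1) * annihilation (orb x 0)) else 0) -
      (∑ b : Λ, if G.Adj x b then T 0 x b • (annihilation (orb x 1) * annihilation (orb b 0)) +
          T 1 x b • (annihilation (orb b 1) * annihilation (orb x 0)) else 0) * (gammaPlus x + gammaMinus x) =
      ∑ b : Λ, if G.Adj x b then T 0 x b • (creation (orb x 0) * annihilation (orb b 0)) +
          T 1 x b • (creation (orb x 1) * annihilation (orb b 1)) else 0 := by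
    rw [comm_sum_ite]
    refine Finset.sum_congr rfl fun b _ => ?_
    split_ifs with hxb
    · have hne : b ≠ x := fun h => G.irrefl (h ▸ hxb)
      rw [comm_two_smul, Matrix.add_mul, Matrix.mul_add, Matrix.add_mul, Matrix.mul_add,
        show ∀ A B C D : Matrix (Finset (Orb Λ)) (Finset (Orb Λ)) ℂ, A + B - (C + D) = (A - C) + (B - D) from
          fun _ _ _ _ => by abel,
        show ∀ A B C D : Matrix (Finset (Orb Λ)) (Finset (Orb Λ)) ℂ, A + B - (C + D) = (A - C) + (B - D) from
          fun _ _ _ _ => by abel,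
        gammaPlus_comm_pairAnn0 hne, gammaMinus_comm_pairAnn0, gammaPlus_comm_pairAnn1 hne, gammaMinus_comm_pairAnn1,
        add_zero, add_zero]
    · rfl
  rw [hP, hM, neg_neg, ← Finset.sum_add_distrib]
  refine Finset.sum_congr rfl fun y _ => ?_
  by_cases hxy : G.Adj x y
  · rw [if_pos hxy.symm, if_pos hxy, if_pos hxy, Fin.sum_univ_two]
    abel
  · rw [if_neg (fun h => hxy h.symm), if_neg hxy, if_neg hxy, add_zero]

/-- **`Σ_x [Γ¹_x, [K(T), Γ¹_x]] = -2 K(T)`**: the total hopping double commutator is minus twice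
the kinetic energy. [cite: Koma2022, (6.25)–(6.26)] -/
theorem sum_gammaOne_doubleComm_hopping (T : Fin 2 → Λ → Λ → ℂ) :
    ∑ x : Λ, (gammaOne x * (peierlsHubbard G T 0 * gammaOne x - gammaOne x * peierlsHubbard G T 0) -
        (peierlsHubbard G T 0 * gammaOne x - gammaOne x * peierlsHubbard G T 0) * gammaOne x) =
      -(2 : ℂ) • peierlsHubbard G T 0 := by
  simp only [gammaOne_doubleComm_hopping]
  rw [peierlsHubbard_zero_eq, smul_neg, neg_smul, neg_neg, two_smul]
  -- both halves of the local sum equal the full hopping sum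
  have h1 : ∑ x : Λ, ∑ y : Λ, (if G.Adj x y then
      ∑ σ : Fin 2, T σ x y • (creation (orb x σ) * annihilation (orb y σ)) else 0) =
      ∑ a : Λ, ∑ b : Λ, ∑ σ : Fin 2, if G.Adj a b then T σ a b • (creation (orb a σ) * annihilation (orb b σ)) else 0 := by
    refine Finset.sum_congr rfl fun a _ => Finset.sum_congr rfl fun b _ => ?_
    by_cases hab : G.Adj a b
    · simp only [hab, if_true]
    · simp only [hab, if_false, Finset.sum_const_zero]
  have h2 : ∑ x : Λ, ∑ y : Λ, (if G.Adj x y then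
      ∑ σ : Fin 2, T σ y x • (creation (orb y σ) * annihilation (orb x σ)) else 0) =
      ∑ a : Λ, ∑ b : Λ, ∑ σ : Fin 2, if G.Adj a b then T σ a b • (creation (orb a σ) * annihilation (orb b σ)) else 0 := by
    rw [Finset.sum_comm]
    refine Finset.sum_congr rfl fun a _ => Finset.sum_congr rfl fun b _ => ?_
    by_cases hab : G.Adj a b
    · simp only [hab, hab.symm, if_true]
    · have hba : ¬G.Adj b a := fun h => hab h.symm
      simp only [hab, hba, if_false, Finset.sum_const_zero]
  rw [← h1]
  conv_rhs => enter [1]; rw [h1, ← h2]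
  rw [← Finset.sum_add_distrib]
  refine Finset.sum_congr rfl fun x _ => ?_
  rw [← Finset.sum_add_distrib]
  refine Finset.sum_congr rfl fun y _ => ?_
  split_ifs
  · rw [← Finset.sum_add_distrib]
  · rw [add_zero]

end Graph

/-! ### `|Re⟨c†_i c_j⟩| ≤ 1` in any Gibbs state -/

section State

variable {n : Type*} [Fintype n] [DecidableEq n]

/-- Positivity of Gibbs expectations, real part. [folklore] -/
private theorem re_gibbsState_nonneg_of_posSemidef (β : ℝ) {H : Matrix n n ℂ} (hH : H.IsHermitian)
    {A : Matrix n n ℂ} (hA : A.PosSemidef) : 0 ≤ (gibbsState β H A).re :=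
  (Complex.nonneg_iff.mp (gibbsState_nonneg_of_posSemidef β hH hA)).1

end State

/-- `0 ≤ Re⟨n_i⟩ ≤ 1` in the Gibbs state of a Hermitian Hamiltonian (`0 ≤ n_i ≤ 1`; the operator-norm
input `‖a^♯‖ ≤ 1` of Koma's (6.26) in state form; positivity of Gibbs states).
[cite: Koma2022, (6.26)] [cite: BratteliRobinson1997, §5.3.1] -/
theorem re_gibbsState_numberAt_mem (β : ℝ) {H : Matrix (Finset (Orb Λ)) (Finset (Orb Λ)) ℂ} (hH : H.IsHermitian)
    (i : Orb Λ) :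
    0 ≤ (gibbsState β H (creation i * annihilation i)).re ∧ (gibbsState β H (creation i * annihilation i)).re ≤ 1 := by
  constructor
  · have hA : (creation i * annihilation i).PosSemidef := by
      rw [← annihilation_conjTranspose]
      exact Matrix.posSemidef_conjTranspose_mul_self _
    exact re_gibbsState_nonneg_of_posSemidef β hH hA
  · have hA : (1 - creation i * annihilation i).PosSemidef := by
      have h : annihilation i * (annihilation i)ᴴ = 1 - creation i * annihilation i := by
        rw [annihilation_conjTranspose, annihilation_mul_creation, if_pos rfl]
      rw [← h]
      exact Matrix.posSemidef_self_mul_conjTranspose _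
    have h0 := re_gibbsState_nonneg_of_posSemidef β hH hA
    rw [map_sub, Complex.sub_re, gibbsState_one β H (partitionFn_pos β hH).ne', Complex.one_re] at h0
    linarith

/-- **`|Re⟨c†_i c_j⟩| ≤ 1`** in the Gibbs state of a Hermitian Hamiltonian (from
`⟨(c_i ± c_j)†(c_i ± c_j)⟩ ≥ 0` and `⟨n⟩ ≤ 1`; the state form of `‖a†_i a_j‖ ≤ 1` used in (6.26)).
[cite: Koma2022, (6.26)] [cite: BratteliRobinson1997, §5.3.1] -/
theorem abs_re_gibbsState_hop_le_one (β : ℝ) {H : Matrix (Finset (Orb Λ)) (Finset (Orb Λ)) ℂ} (hH : H.IsHermitian)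
    (i j : Orb Λ) : |(gibbsState β H (creation i * annihilation j)).re| ≤ 1 := by
  have hni := re_gibbsState_numberAt_mem β hH i
  have hnj := re_gibbsState_numberAt_mem β hH j
  -- `Re⟨c†_j c_i⟩ = Re⟨c†_i c_j⟩`
  have hsymm : (gibbsState β H (creation j * annihilation i)).re = (gibbsState β H (creation i * annihilation j)).re := by
    have h : (creation i * annihilation j)ᴴ = creation j * annihilation i := by
      rw [conjTranspose_mul, annihilation_conjTranspose, creation_conjTranspose]
    rw [← h, gibbsState_conjTranspose β hH, Complex.star_def, Complex.conj_re]
  have hplus : 0 ≤ (gibbsState β H (creation i * annihilation i)).re + (gibbsState β H (creation j * annihilation j)).re +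
      2 * (gibbsState β H (creation i * annihilation j)).re := by
    have hA : ((annihilation i + annihilation j)ᴴ * (annihilation i + annihilation j)).PosSemidef :=
      Matrix.posSemidef_conjTranspose_mul_self _
    have h0 := re_gibbsState_nonneg_of_posSemidef β hH hA
    rw [conjTranspose_add, annihilation_conjTranspose, annihilation_conjTranspose, Matrix.add_mul, Matrix.mul_add,
      Matrix.mul_add, map_add, map_add, map_add, Complex.add_re, Complex.add_re, Complex.add_re, hsymm] at h0
    linarith
  have hminus : 0 ≤ (gibbsState β H (creation i * annihilation i)).re + (gibbsState β H (creation j * annihilation j)).re -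
      2 * (gibbsState β H (creation i * annihilation j)).re := by
    have hA : ((annihilation i - annihilation j)ᴴ * (annihilation i - annihilation j)).PosSemidef :=
      Matrix.posSemidef_conjTranspose_mul_self _
    have h0 := re_gibbsState_nonneg_of_posSemidef β hH hA
    rw [conjTranspose_sub, annihilation_conjTranspose, annihilation_conjTranspose, Matrix.sub_mul, Matrix.mul_sub,
      Matrix.mul_sub, map_sub, map_sub, map_sub, Complex.sub_re, Complex.sub_re, Complex.sub_re, hsymm] at h0
    linarith
  rw [abs_le]
  constructor <;> linarith [hni.2, hnj.2]

end PairHopRP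

/-! ### The `π`-flux model: `Σ_x Re⟨[Γ¹_x,[K(T_π),Γ¹_x]]⟩ ≤ 8(d+1)κ|Λ|` -/

namespace KomaPiFlux

open PairHopRP LiebCutRP FermionTorus
open Literature.Probability.LatticeModels

attribute [local instance] LiebCutRP.decEqTorus

variable {d L : ℕ} [NeZero L]

omit [NeZero L] in
/-- `bondSign x μ ∈ {1, -1}`. [cite: Koma2022, (2.8)–(2.9)] -/
theorem bondSign_sign (x : FermionTorus (d + 1) L) (μ : Fin (d + 1)) : bondSign x μ = 1 ∨ bondSign x μ = -1 := by
  have aux : ∀ a b : ℝ, (a = 1 ∨ a = -1) → (b = 1 ∨ b = -1) → a * b = 1 ∨ a * b = -1 := by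
    rintro a b (rfl | rfl) (rfl | rfl) <;> norm_num
  rw [bondSign_eq]
  exact aux _ _ (neg_one_pow_eq_or ℝ _) (axialSign_eq_or L _)

omit [NeZero L] in
/-- `|Λ| = L^{d+1}`. [folklore] -/
private theorem card_torus : Fintype.card (FermionTorus (d + 1) L) = L ^ (d + 1) := by
  simp only [FermionTorus, Fintype.card_lex, Fintype.card_fun, Fintype.card_fin]

/-- One bond term: `Re⟨T_π(x,y) c†_{xσ}c_{yσ}⟩ ≤ κ` on a bond `y = x ± e_μ` (`|T_π| = κ`, `|Re⟨c†c⟩| ≤ 1`). [cite: Koma2022, (6.26)] -/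
theorem re_gibbsState_piFlux_hop_le (h3 : 3 ≤ L) {κ : ℝ} (hκ : 0 ≤ κ) (β : ℝ)
    {H : Matrix (Finset (Orb (FermionTorus (d + 1) L))) (Finset (Orb (FermionTorus (d + 1) L))) ℂ} (hH : H.IsHermitian)
    (σ : Fin 2) (x : FermionTorus (d + 1) L) (μ : Fin (d + 1)) (i j : Orb (FermionTorus (d + 1) L)) :
    (gibbsState β H (piFluxAmpl κ σ x (shift x μ) • (creation i * annihilation j))).re ≤ κ ∧
      (gibbsState β H (piFluxAmpl κ σ (shift x μ) x • (creation i * annihilation j))).re ≤ κ := by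
  have hb := abs_re_gibbsState_hop_le_one β hH i j
  rw [abs_le] at hb
  rw [piFluxAmpl_shift h3, piFluxAmpl_shift' h3, map_smul, smul_eq_mul, Complex.re_ofReal_mul]
  rcases bondSign_sign x μ with hs | hs <;> rw [hs] <;> constructor <;> nlinarith [hb.1, hb.2]

/-- **Koma's hopping bound (6.26), local thermal form**: for the `π`-flux kinetic term
`K(T_π)` (`κ ≥ 0`, `L ≥ 3`) and the Gibbs state of ANY Hermitian `H`,
`Σ_x Re⟨[Γ¹_x, [K(T_π), Γ¹_x]]⟩_{β,H} ≤ 8(d+1)κ L^{d+1}` (`8Dκ` per site). [cite: Koma2022, (6.26)] -/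
theorem sum_re_gibbsState_doubleComm_hopping_le (h3 : 3 ≤ L) {κ : ℝ} (hκ : 0 ≤ κ) (β : ℝ)
    {H : Matrix (Finset (Orb (FermionTorus (d + 1) L))) (Finset (Orb (FermionTorus (d + 1) L))) ℂ} (hH : H.IsHermitian) :
    ∑ x : FermionTorus (d + 1) L, (gibbsState β H
        (gammaOne x * (peierlsHubbard (G d L) (piFluxAmpl κ) 0 * gammaOne x - gammaOne x * peierlsHubbard (G d L) (piFluxAmpl κ) 0) -
          (peierlsHubbard (G d L) (piFluxAmpl κ) 0 * gammaOne x - gammaOne x * peierlsHubbard (G d L) (piFluxAmpl κ) 0) *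
            gammaOne x)).re ≤
      8 * (d + 1) * κ * (L : ℝ) ^ (d + 1) := by
  rw [← Complex.re_sum, ← map_sum, sum_gammaOne_doubleComm_hopping, peierlsHubbard_zero_eq, smul_neg, neg_smul, neg_neg,
    map_smul, smul_eq_mul, show (2 : ℂ) = ((2 : ℝ) : ℂ) by norm_num, Complex.re_ofReal_mul]
  -- reorganise the bond sum along the lattice directions
  have hsum : (∑ a : FermionTorus (d + 1) L, ∑ b : FermionTorus (d + 1) L, ∑ σ : Fin 2,
      if (G d L).Adj a b then piFluxAmpl κ σ a b • (creation (orb a σ) * annihilation (orb b σ)) else 0) =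
      ∑ x : FermionTorus (d + 1) L, ∑ μ : Fin (d + 1),
        ((∑ σ : Fin 2, piFluxAmpl κ σ x (shift x μ) • (creation (orb x σ) * annihilation (orb (shift x μ) σ))) +
          ∑ σ : Fin 2, piFluxAmpl κ σ (shift x μ) x • (creation (orb (shift x μ) σ) * annihilation (orb x σ))) := by
    rw [sum_shift_add_sum_shift_swap h3 (fun a b => ∑ σ : Fin 2, piFluxAmpl κ σ a b • (creation (orb a σ) * annihilation (orb b σ)))]
    refine Finset.sum_congr rfl fun a _ => Finset.sum_congr rfl fun b _ => ?_
    split_ifs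
    · rfl
    · simp
  rw [hsum, map_sum, Complex.re_sum]
  have hterm : ∀ x : FermionTorus (d + 1) L, (gibbsState β H (∑ μ : Fin (d + 1),
      ((∑ σ : Fin 2, piFluxAmpl κ σ x (shift x μ) • (creation (orb x σ) * annihilation (orb (shift x μ) σ))) +
        ∑ σ : Fin 2, piFluxAmpl κ σ (shift x μ) x • (creation (orb (shift x μ) σ) * annihilation (orb x σ))))).re ≤
      (d + 1) * (4 * κ) := by
    intro x
    rw [map_sum, Complex.re_sum]
    calc ∑ μ : Fin (d + 1), (gibbsState β H
          ((∑ σ : Fin 2, piFluxAmpl κ σ x (shift x μ) • (creation (orb x σ) * annihilation (orb (shift x μ) σ))) +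
            ∑ σ : Fin 2, piFluxAmpl κ σ (shift x μ) x • (creation (orb (shift x μ) σ) * annihilation (orb x σ)))).re
        ≤ ∑ _μ : Fin (d + 1), 4 * κ := by
          refine Finset.sum_le_sum fun μ _ => ?_
          rw [map_add, Complex.add_re, Fin.sum_univ_two, Fin.sum_univ_two, map_add, map_add, Complex.add_re, Complex.add_re]
          have h00 := (re_gibbsState_piFlux_hop_le h3 hκ β hH 0 x μ (orb x 0) (orb (shift x μ) 0)).1
          have h01 := (re_gibbsState_piFlux_hop_le h3 hκ β hH 1 x μ (orb x 1) (orb (shift x μ) 1)).1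
          have h10 := (re_gibbsState_piFlux_hop_le h3 hκ β hH 0 x μ (orb (shift x μ) 0) (orb x 0)).2
          have h11 := (re_gibbsState_piFlux_hop_le h3 hκ β hH 1 x μ (orb (shift x μ) 1) (orb x 1)).2
          linarith
      _ = (d + 1) * (4 * κ) := by rw [Finset.sum_const, Finset.card_univ, Fintype.card_fin, nsmul_eq_mul, Nat.cast_add, Nat.cast_one]
  calc 2 * ∑ x : FermionTorus (d + 1) L, (gibbsState β H (∑ μ : Fin (d + 1),
        ((∑ σ : Fin 2, piFluxAmpl κ σ x (shift x μ) • (creation (orb x σ) * annihilation (orb (shift x μ) σ))) +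
          ∑ σ : Fin 2, piFluxAmpl κ σ (shift x μ) x • (creation (orb (shift x μ) σ) * annihilation (orb x σ))))).re
      ≤ 2 * ∑ _x : FermionTorus (d + 1) L, ((d + 1) * (4 * κ) : ℝ) := by
        gcongr with x _
        exact hterm x
    _ = 8 * (d + 1) * κ * (L : ℝ) ^ (d + 1) := by
        rw [Finset.sum_const, Finset.card_univ, card_torus, nsmul_eq_mul, Nat.cast_pow]
        ring

end KomaPiFlux

end Literature.MathematicalPhysics.QuantumLattice

end
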